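import Literature.AlgebraicGeometry.HodgeTheory.WeilClassesSquareDivisorPolynomial
import HarnessLib

/-!
# The Weil classes of the split and twisted SQUARES as divisor polynomials (instances)

Family `hodge`, layer `Literature/AlgebraicGeometry/HodgeTheory`. The two instances of the abstract square theorem of
`WeilClassesSquareDivisorPolynomial` (intertwining pairs `(q₁, q₂)`, `Φ ≫ q₂ = q₁`, `Φ ≫ q₁ = -d·q₂`; Weil lines
`E_c = ℂ · Ω_c(θ)^{⌣g}`, `Ω_c(θ) = q₁^*θ - d·q₂^*θ + c·((q₁+q₂)^*θ - q₁^*θ - q₂^*θ)`, `c = ±i√d`), with every hypothesis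
discharged except `θ^{⌣g} ≠ 0` (`θ ∈ H²(T(ℂ); ℂ)` arbitrary, e.g. a polarization class):

* Deligne's SPLIT square `(T × T, Φ_d)`, `Φ_d(x, y) = (-d·y, x)` (`WeilClassesSplitSquare`): `q₁ = p₁`, `q₂ = p₂`, so
  `Ω_c = θ₁ - dθ₂ + c·ω` with `θᵢ = pᵢ^*θ` and `ω = (p₁ + p₂)^*θ - θ₁ - θ₂` the mixed class of `θ`
  (`weilClassesPlus_splitSquare_eq_span`, `weilClassesMinus_splitSquare_eq_span`, `weilClassesOf_splitSquare_eq_span`);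
  injectivity of `p₁^* + c·p₂^*` on `H¹(T)` via the section `(𝟙, 0)`.
* The TWISTED square `(T × T, φ × (-φ))`, `φ ≫ φ = -d` (`WeilClassesTwistedSquare`): `q₁ = ψ = p₁ ≫ φ - p₂ ≫ φ`,
  `q₂ = m = p₁ + p₂` — `(m, ψ) : (T × T, φ × (-φ)) → (T × T, Φ_d)`, `(x, y) ↦ (x + y, φ(x - y))`, is the `K`-isogeny onto the
  split square (`twistedSquare_comp_add`, `twistedSquare_comp_sub`) — so `Ω_c = ψ^*θ - d·m^*θ + c·((ψ + m)^*θ - ψ^*θ - m^*θ)`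
  (`weilClassesPlus_twistedSquare_eq_span`, …); injectivity of `ψ^* + c·m^*` via the two sections (`2c·v = 0`).
* NON-EXCEPTIONALITY at both squares (`weilClassesOf_splitSquare_le_divisorClassesSpan`,
  `weilClassesOf_twistedSquare_le_divisorClassesSpan`): `W_K ⊗ ℂ ⊆ Dᵍ ⊗ ℂ = divisorClassesSpan (T × T) (2g) g` as soon as
  `T × T` carries a rational `(1,1)`-class `Θ` with `(s^*Θ)^{⌣g} ≠ 0` for some `s : T ⟶ T × T` (a polarization and
  `s = (𝟙, 0)`) — to be read against the barrier `Literature.Barriers.HodgeConjecture.Weil1977_exceptionalHodgeClasses`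
  (`W ⊄ Dⁿ` at the GENERAL Weil-type abelian variety, van Geemen Thm. 4.11).

For the B2b ladder `hodge-weil` (`LADDER.md ## CARVER v5` C36 (i), `## CARVER v6` C40): at the CM square
`E³(ι) × E³(ῑ) = (T × T, φ × (-φ))`, `T = E³`, `θ = Σ_t [o]_t`, and for a `K`-symmetric `θ` generally (`φ^*θ = dθ`), the
generator collapses to `Ω_± ∝ i√d·ω ∓ ω_φ` (`ω_φ` the mixed class of the graph of `φ`), i.e. the packet's
`w_σ = -∏_t (Ps_t + √-d·P1_t)` up to a unit — a pen-and-paper remark; the typed statements keep `θ` arbitrary. Nothing here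
is a rung; no named fact, no definition.

## References

* [Deligne1982HodgeCycles] P. Deligne, LNM 900 (1982), §4 Lemma 4.5 and Remark 4.10.
* [Schoen1998HodgeWeilAddendum] C. Schoen, Compositio Math. 114 (1998), §10.
* [vanGeemen1994HodgeAV] B. van Geemen, LNM 1594 (1994), §2.4, 4.9, Thm. 4.11, 5.2–5.4.
-/

noncomputable section

open CategoryTheory

namespace Literature.AlgebraicGeometry.HodgeTheory

open Literature.AlgebraicTopology.SingularHomology
open Literature.AlgebraicGeometry.Motives
open Literature.Barriers.HodgeConjecture

section HodgeTheory

variable {T : Motives.AbelianVariety ℂ}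

/-! ### Instance 1: Deligne's split square `(T × T, Φ_d)`, `q₁ = p₁`, `q₂ = p₂` -/

section Split

variable {g d : ℕ}

/-- `L_c = p₁^* + c·p₂^*` is injective on `H¹(T)`: pull back along the section `(𝟙, 0) : T ⟶ T × T`. [folklore] -/
theorem splitSquare_virtual_injective (c : ℂ) (v : complexBetti T.X 1)
    (hv : complexBetti.map (AbelianVariety.fst T T).hom.hom.hom 1 v +
      c • complexBetti.map (AbelianVariety.snd T T).hom.hom.hom 1 v = 0) : v = 0 := by
  have h := congrArg (complexBetti.map (AbelianVariety.prodLift (𝟙 T) (0 : T ⟶ T)).hom.hom.hom 1) hv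
  rw [map_add, map_smul, complexBetti_map_map_hom, complexBetti_map_map_hom, AbelianVariety.prodLift_fst,
    AbelianVariety.prodLift_snd, complexBetti_map_zero_deg_one, smul_zero, add_zero, map_zero] at h
  rw [← abelianVariety_map_id_apply v]
  exact h

/-- **Split square, `E₊`: `weilClassesPlus (T × T) Φ_d g d = ℂ · (θ₁ - dθ₂ + i√d·ω)^{⌣g}`**, `ω = (p₁+p₂)^*θ - θ₁ - θ₂`, for
every `θ ∈ H²(T(ℂ); ℂ)` with `θ^g ≠ 0` (`dim T = g ≥ 1`, `d ≥ 1`). [cite: Deligne1982HodgeCycles, §4 Lemma 4.5 and Remark 4.10] -/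
theorem weilClassesPlus_splitSquare_eq_span (hg : 0 < g) (hT : T.dim = g) (hd : 0 < d) {θ : complexBetti T.X 2}
    (hθ : cupPowTwo θ g ≠ 0) :
    weilClassesPlus (T.prod T)
        (AbelianVariety.prodLift (AbelianVariety.snd T T ≫ (-(d • 𝟙 T))) (AbelianVariety.fst T T)) g d =
      ℂ ∙ cupPowTwo (weilGenerator (AbelianVariety.fst T T) (AbelianVariety.snd T T) d
        (Complex.I * (Real.sqrt d : ℂ)) θ) g :=
  weilClassesPlus_eq_span_cupPowTwo_weilGenerator hg hT (dim_twistedSquare hT) hd splitSquare_comp_self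
    splitSquare_comp_snd (by rw [splitSquare_comp_fst, Preadditive.comp_neg, Preadditive.comp_nsmul, Category.comp_id])
    (fun v hv => splitSquare_virtual_injective _ v hv) hθ

/-- **Split square, `E₋`** (`c = -i√d`). [cite: Deligne1982HodgeCycles, §4 Lemma 4.5 and Remark 4.10] -/
theorem weilClassesMinus_splitSquare_eq_span (hg : 0 < g) (hT : T.dim = g) (hd : 0 < d) {θ : complexBetti T.X 2}
    (hθ : cupPowTwo θ g ≠ 0) :
    weilClassesMinus (T.prod T)
        (AbelianVariety.prodLift (AbelianVariety.snd T T ≫ (-(d • 𝟙 T))) (AbelianVariety.fst T T)) g d =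
      ℂ ∙ cupPowTwo (weilGenerator (AbelianVariety.fst T T) (AbelianVariety.snd T T) d
        (-(Complex.I * (Real.sqrt d : ℂ))) θ) g :=
  weilClassesMinus_eq_span_cupPowTwo_weilGenerator hg hT (dim_twistedSquare hT) hd splitSquare_comp_self
    splitSquare_comp_snd (by rw [splitSquare_comp_fst, Preadditive.comp_neg, Preadditive.comp_nsmul, Category.comp_id])
    (fun v hv => splitSquare_virtual_injective _ v hv) hθ

/-- **Split square, the plane: `W_K ⊗ ℂ = span {(θ₁ - dθ₂ + i√d ω)^g, (θ₁ - dθ₂ - i√d ω)^g}`.**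
[cite: Deligne1982HodgeCycles, §4 Lemma 4.5 and Remark 4.10] [cite: vanGeemen1994HodgeAV, 4.9] -/
theorem weilClassesOf_splitSquare_eq_span (hg : 0 < g) (hT : T.dim = g) (hd : 0 < d) {θ : complexBetti T.X 2}
    (hθ : cupPowTwo θ g ≠ 0) :
    weilClassesOf (T.prod T)
        (AbelianVariety.prodLift (AbelianVariety.snd T T ≫ (-(d • 𝟙 T))) (AbelianVariety.fst T T)) g d =
      Submodule.span ℂ
        {cupPowTwo (weilGenerator (AbelianVariety.fst T T) (AbelianVariety.snd T T) d (Complex.I * (Real.sqrt d : ℂ)) θ) g,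
          cupPowTwo (weilGenerator (AbelianVariety.fst T T) (AbelianVariety.snd T T) d
            (-(Complex.I * (Real.sqrt d : ℂ))) θ) g} :=
  weilClassesOf_eq_span_cupPowTwo_weilGenerator hg hT (dim_twistedSquare hT) hd splitSquare_comp_self
    splitSquare_comp_snd (by rw [splitSquare_comp_fst, Preadditive.comp_neg, Preadditive.comp_nsmul, Category.comp_id])
    (fun c v _ hv => splitSquare_virtual_injective c v hv) hθ

/-- **Split square, non-exceptionality: `W_K(T × T, Φ_d) ⊗ ℂ ⊆ Dᵍ(T × T) ⊗ ℂ`** whenever `T × T` carries a rational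
`(1,1)`-class `Θ` whose restriction to some `s : T ⟶ T × T` has non-zero top power (e.g. a polarization and `s = (𝟙, 0)`).
[cite: vanGeemen1994HodgeAV, §2.4 and Thm. 4.11] [cite: Deligne1982HodgeCycles, §4 Remark 4.10] -/
theorem weilClassesOf_splitSquare_le_divisorClassesSpan (hg : 0 < g) (hT : T.dim = g) (hd : 0 < d)
    (s : T ⟶ T.prod T) {Θ : complexBetti (T.prod T).X 2} (hΘ : IsRationalClass Θ)
    (hΘ11 : IsOfHodgeType (2 * g) (T.prod T).X 2 1 1 Θ) (hθ : cupPowTwo (complexBetti.map s.hom.hom.hom 2 Θ) g ≠ 0) :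
    weilClassesOf (T.prod T)
        (AbelianVariety.prodLift (AbelianVariety.snd T T ≫ (-(d • 𝟙 T))) (AbelianVariety.fst T T)) g d ≤
      divisorClassesSpan (T.prod T).X (2 * g) g :=
  weilClassesOf_le_divisorClassesSpan_of_intertwining hg hT (dim_twistedSquare hT) hd splitSquare_comp_self
    splitSquare_comp_snd (by rw [splitSquare_comp_fst, Preadditive.comp_neg, Preadditive.comp_nsmul, Category.comp_id])
    (fun c v _ hv => splitSquare_virtual_injective c v hv) s hΘ hΘ11 hθ

end Split

/-! ### Instance 2: the twisted square `(T × T, φ × (-φ))`, `q₁ = ψ = p₁ ≫ φ - p₂ ≫ φ`, `q₂ = m = p₁ + p₂` -/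

section Twisted

variable {g d : ℕ} {φ : T ⟶ T}

/-- `Φ ≫ m = ψ` for `Φ = φ × (-φ)`, `m = p₁ + p₂`, `ψ = p₁ ≫ φ - p₂ ≫ φ`. [folklore] -/
theorem twistedSquare_comp_add :
    AbelianVariety.prodLift (AbelianVariety.fst T T ≫ φ) (AbelianVariety.snd T T ≫ (-φ)) ≫
        (AbelianVariety.fst T T + AbelianVariety.snd T T) =
      AbelianVariety.fst T T ≫ φ - AbelianVariety.snd T T ≫ φ := by
  rw [Preadditive.comp_add, twistedSquare_comp_fst, twistedSquare_comp_snd, Preadditive.comp_neg, sub_eq_add_neg]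

/-- `Φ ≫ ψ = -d·m` for `Φ = φ × (-φ)` with `φ ≫ φ = -d`. [folklore] -/
theorem twistedSquare_comp_sub (hφ : φ ≫ φ = -(d • 𝟙 T)) :
    AbelianVariety.prodLift (AbelianVariety.fst T T ≫ φ) (AbelianVariety.snd T T ≫ (-φ)) ≫
        (AbelianVariety.fst T T ≫ φ - AbelianVariety.snd T T ≫ φ) =
      -(d • (AbelianVariety.fst T T + AbelianVariety.snd T T)) := by
  rw [Preadditive.comp_sub, ← Category.assoc, ← Category.assoc, twistedSquare_comp_fst, twistedSquare_comp_snd,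
    Category.assoc, Category.assoc, Preadditive.neg_comp, hφ]
  simp only [neg_neg, Preadditive.comp_neg, Preadditive.comp_nsmul, Category.comp_id, smul_add]
  abel

/-- `L_c = ψ^* + c·m^*` is injective on `H¹(T)` for `c ≠ 0`: pulling back along the two sections `(𝟙, 0)`, `(0, 𝟙)` gives
`φ^*v + c v = 0` and `-φ^*v + c v = 0`, hence `2c·v = 0`. [folklore] -/
theorem twistedSquare_virtual_injective {c : ℂ} (hc : c ≠ 0) (v : complexBetti T.X 1)
    (hv : complexBetti.map (AbelianVariety.fst T T ≫ φ - AbelianVariety.snd T T ≫ φ).hom.hom.hom 1 v +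
      c • complexBetti.map (AbelianVariety.fst T T + AbelianVariety.snd T T).hom.hom.hom 1 v = 0) : v = 0 := by
  have key : ∀ s : T ⟶ T.prod T,
      complexBetti.map (s ≫ (AbelianVariety.fst T T ≫ φ - AbelianVariety.snd T T ≫ φ)).hom.hom.hom 1 v +
        c • complexBetti.map (s ≫ (AbelianVariety.fst T T + AbelianVariety.snd T T)).hom.hom.hom 1 v = 0 := by
    intro s
    have h := congrArg (complexBetti.map s.hom.hom.hom 1) hv
    rwa [map_add, map_smul, complexBetti_map_map_hom, complexBetti_map_map_hom, map_zero] at h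
  have h1 := key (AbelianVariety.prodLift (𝟙 T) 0)
  have h2 := key (AbelianVariety.prodLift 0 (𝟙 T))
  simp only [Preadditive.comp_sub, Preadditive.comp_add, ← Category.assoc, AbelianVariety.prodLift_fst,
    AbelianVariety.prodLift_snd, Category.id_comp, Limits.zero_comp, sub_zero, add_zero, zero_sub, zero_add] at h1 h2
  have hid : complexBetti.map (𝟙 T : T ⟶ T).hom.hom.hom 1 v = v := abelianVariety_map_id_apply v
  rw [hid] at h1 h2
  rw [complexBetti_map_neg_deg_one] at h2
  have hsum : (2 * c) • v = 0 := by
    have := congrArg₂ (· + ·) h1 h2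
    simp only [add_zero] at this
    rw [← this]
    module
  exact (smul_eq_zero.mp hsum).resolve_left (mul_ne_zero two_ne_zero hc)

/-- **Twisted square, `E₊`: `weilClassesPlus (T × T) (φ × (-φ)) g d = ℂ · Ω₊^g`** with
`Ω₊ = ψ^*θ - d·m^*θ + i√d·((ψ + m)^*θ - ψ^*θ - m^*θ)`, `m = p₁ + p₂`, `ψ = p₁ ≫ φ - p₂ ≫ φ`, for every `θ ∈ H²(T(ℂ); ℂ)` with
`θ^g ≠ 0` (`dim T = g ≥ 1`, `φ ≫ φ = -d`, `d ≥ 1`). [cite: Schoen1998HodgeWeilAddendum, §10]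
[cite: Deligne1982HodgeCycles, §4 Lemma 4.5 and Remark 4.10] -/
theorem weilClassesPlus_twistedSquare_eq_span (hg : 0 < g) (hT : T.dim = g) (hd : 0 < d) (hφ : φ ≫ φ = -(d • 𝟙 T))
    {θ : complexBetti T.X 2} (hθ : cupPowTwo θ g ≠ 0) :
    weilClassesPlus (T.prod T)
        (AbelianVariety.prodLift (AbelianVariety.fst T T ≫ φ) (AbelianVariety.snd T T ≫ (-φ))) g d =
      ℂ ∙ cupPowTwo (weilGenerator (AbelianVariety.fst T T ≫ φ - AbelianVariety.snd T T ≫ φ)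
        (AbelianVariety.fst T T + AbelianVariety.snd T T) d (Complex.I * (Real.sqrt d : ℂ)) θ) g :=
  weilClassesPlus_eq_span_cupPowTwo_weilGenerator hg hT (dim_twistedSquare hT) hd (twistedSquare_comp_self hφ)
    twistedSquare_comp_add (twistedSquare_comp_sub hφ)
    (fun v hv => twistedSquare_virtual_injective (I_mul_sqrt_ne_zero hd) v hv) hθ

/-- **Twisted square, `E₋`** (`c = -i√d`). [cite: Schoen1998HodgeWeilAddendum, §10] [cite: Deligne1982HodgeCycles, §4 Remark 4.10] -/
theorem weilClassesMinus_twistedSquare_eq_span (hg : 0 < g) (hT : T.dim = g) (hd : 0 < d) (hφ : φ ≫ φ = -(d • 𝟙 T))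
    {θ : complexBetti T.X 2} (hθ : cupPowTwo θ g ≠ 0) :
    weilClassesMinus (T.prod T)
        (AbelianVariety.prodLift (AbelianVariety.fst T T ≫ φ) (AbelianVariety.snd T T ≫ (-φ))) g d =
      ℂ ∙ cupPowTwo (weilGenerator (AbelianVariety.fst T T ≫ φ - AbelianVariety.snd T T ≫ φ)
        (AbelianVariety.fst T T + AbelianVariety.snd T T) d (-(Complex.I * (Real.sqrt d : ℂ))) θ) g :=
  weilClassesMinus_eq_span_cupPowTwo_weilGenerator hg hT (dim_twistedSquare hT) hd (twistedSquare_comp_self hφ)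
    twistedSquare_comp_add (twistedSquare_comp_sub hφ)
    (fun v hv => twistedSquare_virtual_injective (neg_ne_zero.mpr (I_mul_sqrt_ne_zero hd)) v hv) hθ

/-- **Twisted square, the plane: `W_K ⊗ ℂ = span {Ω₊^g, Ω₋^g}`.** [cite: Schoen1998HodgeWeilAddendum, §10]
[cite: vanGeemen1994HodgeAV, 4.9] -/
theorem weilClassesOf_twistedSquare_eq_span (hg : 0 < g) (hT : T.dim = g) (hd : 0 < d) (hφ : φ ≫ φ = -(d • 𝟙 T))
    {θ : complexBetti T.X 2} (hθ : cupPowTwo θ g ≠ 0) :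
    weilClassesOf (T.prod T)
        (AbelianVariety.prodLift (AbelianVariety.fst T T ≫ φ) (AbelianVariety.snd T T ≫ (-φ))) g d =
      Submodule.span ℂ
        {cupPowTwo (weilGenerator (AbelianVariety.fst T T ≫ φ - AbelianVariety.snd T T ≫ φ)
            (AbelianVariety.fst T T + AbelianVariety.snd T T) d (Complex.I * (Real.sqrt d : ℂ)) θ) g,
          cupPowTwo (weilGenerator (AbelianVariety.fst T T ≫ φ - AbelianVariety.snd T T ≫ φ)
            (AbelianVariety.fst T T + AbelianVariety.snd T T) d (-(Complex.I * (Real.sqrt d : ℂ))) θ) g} := by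
  refine weilClassesOf_eq_span_cupPowTwo_weilGenerator hg hT (dim_twistedSquare hT) hd (twistedSquare_comp_self hφ)
    twistedSquare_comp_add (twistedSquare_comp_sub hφ) (fun c v hc hv => ?_) hθ
  have hc0 : c ≠ 0 := by
    rintro rfl
    rw [zero_mul, eq_comm, neg_eq_zero, Nat.cast_eq_zero] at hc
    omega
  exact twistedSquare_virtual_injective hc0 v hv

/-- **Twisted square, non-exceptionality: `W_K(T × T, φ × (-φ)) ⊗ ℂ ⊆ Dᵍ(T × T) ⊗ ℂ`** whenever `T × T` carries a rational
`(1,1)`-class `Θ` whose restriction along some `s : T ⟶ T × T` has non-zero top power. In every sixfold component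
`(K, 3, δ)` — split or not — the twisted squares are thus points where the Weil classes are divisor polynomials.
[cite: vanGeemen1994HodgeAV, §2.4 and Thm. 4.11] [cite: Schoen1998HodgeWeilAddendum, §10] -/
theorem weilClassesOf_twistedSquare_le_divisorClassesSpan (hg : 0 < g) (hT : T.dim = g) (hd : 0 < d)
    (hφ : φ ≫ φ = -(d • 𝟙 T)) (s : T ⟶ T.prod T) {Θ : complexBetti (T.prod T).X 2} (hΘ : IsRationalClass Θ)
    (hΘ11 : IsOfHodgeType (2 * g) (T.prod T).X 2 1 1 Θ) (hθ : cupPowTwo (complexBetti.map s.hom.hom.hom 2 Θ) g ≠ 0) :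
    weilClassesOf (T.prod T)
        (AbelianVariety.prodLift (AbelianVariety.fst T T ≫ φ) (AbelianVariety.snd T T ≫ (-φ))) g d ≤
      divisorClassesSpan (T.prod T).X (2 * g) g := by
  refine weilClassesOf_le_divisorClassesSpan_of_intertwining hg hT (dim_twistedSquare hT) hd (twistedSquare_comp_self hφ)
    twistedSquare_comp_add (twistedSquare_comp_sub hφ) (fun c v hc hv => ?_) s hΘ hΘ11 hθ
  have hc0 : c ≠ 0 := by
    rintro rfl
    rw [zero_mul, eq_comm, neg_eq_zero, Nat.cast_eq_zero] at hc
    omega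
  exact twistedSquare_virtual_injective hc0 v hv

end Twisted

end HodgeTheory

end Literature.AlgebraicGeometry.HodgeTheory

end
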